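import Literature.AlgebraicGeometry.ShimuraVarieties.UnitaryCurveConeExtension
import HarnessLib

/-!
# Crux `HLiu418`, K-lane E₂ — frame geometry of a rank-2 cone frame WITHOUT hermitian symmetry, I: frame coordinates and the holomorphic
# SLICE `s(z) = 1 + z N` of the cone-open (the disc-identity route to the archimedean core S2⁺₂)

Cell `hodgecm-mathlib`, FLOOR 0, programme P5 (`F0_AlbCm`); crux item `stmt-HodgeConjecture-24832`; seat F0P5-p02 (g2),
`--supports stmt-HodgeConjecture-24832` (helper).  THEOREMS ONLY (existential statements; no definition, no instance, no notation, no `sorry`).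

For a cone frame `𝔣 = (v₀, t₀)` of ★ `UnitaryCurveForms.ConeFrame E J w₁` (`⟪v₀,v₀⟫` of negative real part, `⟪t₀,t₀⟫` of positive real
part, `⟪t₀, v₀⟫ = 0` for `⟪x, y⟫ := x̄ᵀ σ_{w₁}(J) y`) we do NOT assume `σ_{w₁}J` hermitian (the P5 letters carry `J = H` with
`formCongr c g (t • H) = diag dV`, so `σ_{w₁}H` is hermitian only up to the scalar `σ(t)`); instead the two consequences of «hermitian up to a
scalar» that matter are hypotheses: `⟪v₀, t₀⟫ = 0` (`hvt`) and `⟪v₀,v₀⟫ = −r ⟪t₀,t₀⟫` with `r > 0` real (`hvv`).  Then: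
* §1 frame coordinates `x = (⟪t₀,x⟫/⟪t₀,t₀⟫) t₀ + (⟪v₀,x⟫/⟪v₀,v₀⟫) v₀`, matrices are determined by their values on the frame, vectors by their
  pairings with the frame, and `gᴴ σJ g = σJ` is checked on frame pairs;
* §2 the nilpotent `N` (`N v₀ = t₀`, `N t₀ = 0`, `N² = 0`) and the SLICE `s(z) = 1 + z N`: invertible, `s(z) v₀ = v₀ + z t₀`, `s(z) t₀ = t₀`,
  and `s(z) v₀` is negative iff `|z|² < r` — a holomorphic disc of radius `√r` through `1` inside the cone-open of ★ `IsConeHol`;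
The companion ★-candidate `Theorems/HLiu418E2DiscBoost` builds the ROTATIONS `k_w` and BOOSTS `u_z` of `U` on this toolkit; both are consumed by
★-candidate `Theorems/HLiu418E2ArchOrthHol` (S2⁺₂ `ArchOrthHolType₂` by the disc identity).  Builds on A-p14's ★
`ShimuraVarieties/UnitaryCurveConeExtension` §1/§3 (`form_v₀_ne_zero`, `form_t₀_ne_zero`, `form_mulVec_mulVec`, `isUnit_and_mulVec_mem_negCone`).
HONEST LABEL: HC_CM is proved only modulo the 7 printed citations until rung 0 closes; this file discharges none of them.

## References
* [Borel1997] A. Borel, *Automorphic forms on SL₂(ℝ)* (1997), §5.13–§5.14 (automorphy factors on the disc).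
* [BergeronMillsonMoeglin2016Balls] N. Bergeron, J. Millson, C. Moeglin, Acta Math. 216 (2016), Part 2 §1.3 (negative lines).
* [Jacobson] N. Jacobson, *Basic Algebra I*, Ch. V §7, §11 (hermitian forms, unitary groups; Witt).
-/

set_option autoImplicit false
-- the mandated namespace has the single-problem summit's repeated segment (`HodgeConjecture.HodgeConjecture`)
set_option linter.dupNamespace false

noncomputable section

open Matrix NumberField NumberField.InfinitePlace
open scoped Matrix ComplexConjugate ComplexOrder
open Literature.NumberTheory.Automorphic Literature.NumberTheory.Automorphic.UnitaryGroup
open Literature.NumberTheory.Automorphic.UnitaryCurveForms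
open Literature.AlgebraicGeometry.ShimuraVarieties Literature.AlgebraicGeometry.ShimuraVarieties.UnitaryCurveCone

namespace Summit.HodgeConjecture.HodgeConjecture.Cruxes.HLiu418.E2DiscSlice

variable {E : Type} [Field E] {J : Matrix (Fin 2) (Fin 2) E} {w₁ : {w : InfinitePlace E // IsComplex w}} (𝔣 : ConeFrame E J w₁)

/-! ## §1 Frame coordinates without hermitian symmetry -/

/-- A vector `a • t₀ + d • v₀` pairs with `t₀` to `a ⟪t₀,t₀⟫` and with `v₀` to `d ⟪v₀,v₀⟫` (given `⟪v₀,t₀⟫ = 0`).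
[cite: Jacobson, Ch. V §7 pp. 150–151] -/
theorem form_frame_combination (hvt : star 𝔣.v₀ ⬝ᵥ (J.map w₁.1.embedding *ᵥ 𝔣.t₀) = 0) (a d : ℂ) :
    star 𝔣.t₀ ⬝ᵥ (J.map w₁.1.embedding *ᵥ (a • 𝔣.t₀ + d • 𝔣.v₀)) = a * (star 𝔣.t₀ ⬝ᵥ (J.map w₁.1.embedding *ᵥ 𝔣.t₀)) ∧
    star 𝔣.v₀ ⬝ᵥ (J.map w₁.1.embedding *ᵥ (a • 𝔣.t₀ + d • 𝔣.v₀)) = d * (star 𝔣.v₀ ⬝ᵥ (J.map w₁.1.embedding *ᵥ 𝔣.v₀)) := by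
  constructor
  · rw [mulVec_add, mulVec_smul, mulVec_smul, dotProduct_add, dotProduct_smul, dotProduct_smul, smul_eq_mul, smul_eq_mul, 𝔣.orth,
      mul_zero, add_zero]
  · rw [mulVec_add, mulVec_smul, mulVec_smul, dotProduct_add, dotProduct_smul, dotProduct_smul, smul_eq_mul, smul_eq_mul, hvt,
      mul_zero, zero_add]

/-- The frame is linearly independent (pair with `t₀` and `v₀`). [cite: Jacobson, Ch. V §7 pp. 150–151] -/
theorem linearIndependent_frame' (hvt : star 𝔣.v₀ ⬝ᵥ (J.map w₁.1.embedding *ᵥ 𝔣.t₀) = 0) : LinearIndependent ℂ ![𝔣.t₀, 𝔣.v₀] := by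
  rw [LinearIndependent.pair_iff]
  intro a d h
  obtain ⟨h1, h2⟩ := form_frame_combination 𝔣 hvt a d
  rw [h, mulVec_zero, dotProduct_zero] at h1 h2
  exact ⟨(mul_eq_zero.1 h1.symm).resolve_right (form_t₀_ne_zero 𝔣), (mul_eq_zero.1 h2.symm).resolve_right (form_v₀_ne_zero 𝔣)⟩

/-- **Frame coordinates**: every `x ∈ ℂ²` is `(⟪t₀,x⟫/⟪t₀,t₀⟫) t₀ + (⟪v₀,x⟫/⟪v₀,v₀⟫) v₀`. [cite: Jacobson, Ch. V §7 pp. 150–151] -/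
theorem frame_decomp (hvt : star 𝔣.v₀ ⬝ᵥ (J.map w₁.1.embedding *ᵥ 𝔣.t₀) = 0) (x : Fin 2 → ℂ) :
    x = ((star 𝔣.t₀ ⬝ᵥ (J.map w₁.1.embedding *ᵥ x)) * (star 𝔣.t₀ ⬝ᵥ (J.map w₁.1.embedding *ᵥ 𝔣.t₀))⁻¹) • 𝔣.t₀ +
      ((star 𝔣.v₀ ⬝ᵥ (J.map w₁.1.embedding *ᵥ x)) * (star 𝔣.v₀ ⬝ᵥ (J.map w₁.1.embedding *ᵥ 𝔣.v₀))⁻¹) • 𝔣.v₀ := by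
  have hli := linearIndependent_frame' 𝔣 hvt
  have hcard : Fintype.card (Fin 2) = Module.finrank ℂ (Fin 2 → ℂ) := by simp
  let B := basisOfLinearIndependentOfCardEqFinrank hli hcard
  have h := B.sum_repr x
  rw [Fin.sum_univ_two] at h
  have hB0 : B 0 = 𝔣.t₀ := by simp [B]
  have hB1 : B 1 = 𝔣.v₀ := by simp [B]
  rw [hB0, hB1] at h
  obtain ⟨h1, h2⟩ := form_frame_combination 𝔣 hvt (B.repr x 0) (B.repr x 1)
  rw [h] at h1 h2
  conv_lhs => rw [← h]
  rw [h1, h2, mul_inv_cancel_right₀ (form_t₀_ne_zero 𝔣), mul_inv_cancel_right₀ (form_v₀_ne_zero 𝔣)]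

/-- A linear map vanishing on the frame vanishes. [cite: Jacobson, Ch. V §7 pp. 150–151] -/
theorem mulVec_eq_zero_of_frame (hvt : star 𝔣.v₀ ⬝ᵥ (J.map w₁.1.embedding *ᵥ 𝔣.t₀) = 0) {M : Matrix (Fin 2) (Fin 2) ℂ}
    (ht : M *ᵥ 𝔣.t₀ = 0) (hv : M *ᵥ 𝔣.v₀ = 0) (x : Fin 2 → ℂ) : M *ᵥ x = 0 := by
  rw [frame_decomp 𝔣 hvt x, mulVec_add, mulVec_smul, mulVec_smul, ht, hv, smul_zero, smul_zero, add_zero]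

/-- **Matrices are determined by their values on the frame.** [cite: Jacobson, Ch. V §7 pp. 150–151] -/
theorem matrix_eq_of_frame (hvt : star 𝔣.v₀ ⬝ᵥ (J.map w₁.1.embedding *ᵥ 𝔣.t₀) = 0) {M M' : Matrix (Fin 2) (Fin 2) ℂ}
    (ht : M *ᵥ 𝔣.t₀ = M' *ᵥ 𝔣.t₀) (hv : M *ᵥ 𝔣.v₀ = M' *ᵥ 𝔣.v₀) : M = M' := by
  have h : ∀ x, (M - M') *ᵥ x = 0 := fun x =>
    mulVec_eq_zero_of_frame 𝔣 hvt (by rw [sub_mulVec, ht, sub_self]) (by rw [sub_mulVec, hv, sub_self]) x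
  rw [← sub_eq_zero]
  ext i j
  have hij := congrFun (h (Pi.single j 1)) i
  rw [mulVec_single_one] at hij
  simpa using hij

/-- **Vectors are determined by their pairings with the frame** (`y ↦ ⟪t₀, y⟫`, `y ↦ ⟪v₀, y⟫` through `σJ`): if `σJ y` and `σJ y'` have the
same frame pairings then `⟪x, y⟫ = ⟪x, y'⟫` for every `x`. [cite: Jacobson, Ch. V §7 pp. 150–151] -/
theorem form_eq_of_frame (hvt : star 𝔣.v₀ ⬝ᵥ (J.map w₁.1.embedding *ᵥ 𝔣.t₀) = 0) {y y' : Fin 2 → ℂ}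
    (ht : star 𝔣.t₀ ⬝ᵥ (J.map w₁.1.embedding *ᵥ y) = star 𝔣.t₀ ⬝ᵥ (J.map w₁.1.embedding *ᵥ y'))
    (hv : star 𝔣.v₀ ⬝ᵥ (J.map w₁.1.embedding *ᵥ y) = star 𝔣.v₀ ⬝ᵥ (J.map w₁.1.embedding *ᵥ y')) (x : Fin 2 → ℂ) :
    star x ⬝ᵥ (J.map w₁.1.embedding *ᵥ y) = star x ⬝ᵥ (J.map w₁.1.embedding *ᵥ y') := by
  rw [frame_decomp 𝔣 hvt x]
  simp only [star_add, star_smul, add_dotProduct, smul_dotProduct, smul_eq_mul, ht, hv]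

/-- **Unitarity is checked on frame pairs**: if `⟪g x, g y⟫ = ⟪x, y⟫` for `x, y ∈ {t₀, v₀}` then `gᴴ σJ g = σJ`.
[cite: Jacobson, Ch. V §11 p. 162] -/
theorem conjTranspose_mul_mul_eq_of_frame (hvt : star 𝔣.v₀ ⬝ᵥ (J.map w₁.1.embedding *ᵥ 𝔣.t₀) = 0) {g : Matrix (Fin 2) (Fin 2) ℂ}
    (htt : star (g *ᵥ 𝔣.t₀) ⬝ᵥ (J.map w₁.1.embedding *ᵥ (g *ᵥ 𝔣.t₀)) = star 𝔣.t₀ ⬝ᵥ (J.map w₁.1.embedding *ᵥ 𝔣.t₀))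
    (htv : star (g *ᵥ 𝔣.t₀) ⬝ᵥ (J.map w₁.1.embedding *ᵥ (g *ᵥ 𝔣.v₀)) = 0)
    (hvt' : star (g *ᵥ 𝔣.v₀) ⬝ᵥ (J.map w₁.1.embedding *ᵥ (g *ᵥ 𝔣.t₀)) = 0)
    (hvv : star (g *ᵥ 𝔣.v₀) ⬝ᵥ (J.map w₁.1.embedding *ᵥ (g *ᵥ 𝔣.v₀)) = star 𝔣.v₀ ⬝ᵥ (J.map w₁.1.embedding *ᵥ 𝔣.v₀)) :
    gᴴ * J.map w₁.1.embedding * g = J.map w₁.1.embedding := by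
  -- `⟪x, (gᴴ σJ g) y⟫ = ⟪g x, g y⟫`
  have key : ∀ x y : Fin 2 → ℂ, star x ⬝ᵥ ((gᴴ * J.map w₁.1.embedding * g) *ᵥ y) =
      star (g *ᵥ x) ⬝ᵥ (J.map w₁.1.embedding *ᵥ (g *ᵥ y)) := fun x y => by
    rw [star_mulVec, ← dotProduct_mulVec, mulVec_mulVec, mulVec_mulVec, Matrix.mul_assoc]
  -- the two sesquilinear forms agree on frame pairs, hence everywhere
  have hy : ∀ y : Fin 2 → ℂ, ∀ x : Fin 2 → ℂ, star x ⬝ᵥ ((gᴴ * J.map w₁.1.embedding * g) *ᵥ y) = star x ⬝ᵥ (J.map w₁.1.embedding *ᵥ y) := by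
    intro y
    -- first for `y ∈ {t₀, v₀}` and all `x`, by `form_eq_of_frame` applied to `σJ⁻¹`-free pairings: we expand `x` instead
    have hframe : ∀ x : Fin 2 → ℂ,
        star x ⬝ᵥ ((gᴴ * J.map w₁.1.embedding * g) *ᵥ 𝔣.t₀) = star x ⬝ᵥ (J.map w₁.1.embedding *ᵥ 𝔣.t₀) ∧
        star x ⬝ᵥ ((gᴴ * J.map w₁.1.embedding * g) *ᵥ 𝔣.v₀) = star x ⬝ᵥ (J.map w₁.1.embedding *ᵥ 𝔣.v₀) := by
      intro x
      rw [frame_decomp 𝔣 hvt x]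
      simp only [star_add, star_smul, add_dotProduct, smul_dotProduct, smul_eq_mul]
      have e1 : star 𝔣.t₀ ⬝ᵥ ((gᴴ * J.map w₁.1.embedding * g) *ᵥ 𝔣.t₀) = star 𝔣.t₀ ⬝ᵥ (J.map w₁.1.embedding *ᵥ 𝔣.t₀) := by
        rw [key, htt]
      have e2 : star 𝔣.v₀ ⬝ᵥ ((gᴴ * J.map w₁.1.embedding * g) *ᵥ 𝔣.t₀) = star 𝔣.v₀ ⬝ᵥ (J.map w₁.1.embedding *ᵥ 𝔣.t₀) := by
        rw [key, hvt', hvt]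
      have e3 : star 𝔣.t₀ ⬝ᵥ ((gᴴ * J.map w₁.1.embedding * g) *ᵥ 𝔣.v₀) = star 𝔣.t₀ ⬝ᵥ (J.map w₁.1.embedding *ᵥ 𝔣.v₀) := by
        rw [key, htv, 𝔣.orth]
      have e4 : star 𝔣.v₀ ⬝ᵥ ((gᴴ * J.map w₁.1.embedding * g) *ᵥ 𝔣.v₀) = star 𝔣.v₀ ⬝ᵥ (J.map w₁.1.embedding *ᵥ 𝔣.v₀) := by
        rw [key, hvv]
      rw [e1, e2, e3, e4]
      exact ⟨rfl, rfl⟩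
    intro x
    rw [frame_decomp 𝔣 hvt y]
    simp only [mulVec_add, mulVec_smul, dotProduct_add, dotProduct_smul, smul_eq_mul, (hframe x).1, (hframe x).2]
  ext i j
  have h := hy (Pi.single j 1) (Pi.single i 1)
  rw [mulVec_single_one, mulVec_single_one] at h
  simpa [Pi.single_apply] using h

/-! ## §2 The nilpotent `N` and the holomorphic slice `s(z) = 1 + z N` -/

/-- **The nilpotent of the frame**: `N v₀ = t₀`, `N t₀ = 0`, `N² = 0` (`N = ⟪v₀,v₀⟫⁻¹ · t₀ ⊗ (v₀ᴴ σJ)`).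
[cite: Borel1997, §5.13–§5.14] -/
theorem exists_nilpotent (hvt : star 𝔣.v₀ ⬝ᵥ (J.map w₁.1.embedding *ᵥ 𝔣.t₀) = 0) :
    ∃ N : Matrix (Fin 2) (Fin 2) ℂ, N *ᵥ 𝔣.v₀ = 𝔣.t₀ ∧ N *ᵥ 𝔣.t₀ = 0 ∧ N * N = 0 := by
  set c : ℂ := (star 𝔣.v₀ ⬝ᵥ (J.map w₁.1.embedding *ᵥ 𝔣.v₀))⁻¹ with hc
  set N : Matrix (Fin 2) (Fin 2) ℂ := vecMulVec 𝔣.t₀ (c • (star 𝔣.v₀ ᵥ* J.map w₁.1.embedding)) with hN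
  have hNx : ∀ x, N *ᵥ x = (c * (star 𝔣.v₀ ⬝ᵥ (J.map w₁.1.embedding *ᵥ x))) • 𝔣.t₀ := fun x => by
    rw [hN, Matrix.vecMulVec_mulVec, op_smul_eq_smul, smul_dotProduct, dotProduct_mulVec, smul_eq_mul]
  have hv : N *ᵥ 𝔣.v₀ = 𝔣.t₀ := by rw [hNx, hc, inv_mul_cancel₀ (form_v₀_ne_zero 𝔣), one_smul]
  have ht : N *ᵥ 𝔣.t₀ = 0 := by rw [hNx, hvt, mul_zero, zero_smul]
  refine ⟨N, hv, ht, matrix_eq_of_frame 𝔣 hvt ?_ ?_⟩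
  · rw [← mulVec_mulVec, ht, mulVec_zero, zero_mulVec]
  · rw [← mulVec_mulVec, hv, ht, zero_mulVec]

/-- **The slice** `s(z) = 1 + z N`: `s(z) v₀ = v₀ + z t₀`, `s(z) t₀ = t₀`, `s(z) s(−z) = 1`. [cite: Borel1997, §5.13–§5.14] -/
theorem slice_props {N : Matrix (Fin 2) (Fin 2) ℂ} (hNv : N *ᵥ 𝔣.v₀ = 𝔣.t₀) (hNt : N *ᵥ 𝔣.t₀ = 0) (hNN : N * N = 0) (z : ℂ) :
    (1 + z • N) *ᵥ 𝔣.v₀ = 𝔣.v₀ + z • 𝔣.t₀ ∧ (1 + z • N) *ᵥ 𝔣.t₀ = 𝔣.t₀ ∧ (1 + z • N) * (1 + (-z) • N) = 1 ∧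
      (1 + (-z) • N) * (1 + z • N) = 1 := by
  have hsq : ∀ a b : ℂ, (a • N) * (b • N) = 0 := fun a b => by rw [smul_mul_smul_comm, hNN, smul_zero]
  refine ⟨by rw [add_mulVec, one_mulVec, smul_mulVec, hNv], by rw [add_mulVec, one_mulVec, smul_mulVec, hNt, smul_zero, add_zero], ?_, ?_⟩
  · rw [add_mul, mul_add, mul_add, one_mul, mul_one, one_mul, hsq, add_zero, neg_smul]
    abel
  · rw [add_mul, mul_add, mul_add, one_mul, mul_one, one_mul, hsq, add_zero, neg_smul]
    abel

/-- The slice is invertible. [cite: Borel1997, §5.13–§5.14] -/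
theorem isUnit_slice {N : Matrix (Fin 2) (Fin 2) ℂ} (hNv : N *ᵥ 𝔣.v₀ = 𝔣.t₀) (hNt : N *ᵥ 𝔣.t₀ = 0) (hNN : N * N = 0) (z : ℂ) :
    IsUnit (1 + z • N) :=
  ⟨⟨1 + z • N, 1 + (-z) • N, (slice_props 𝔣 hNv hNt hNN z).2.2.1, (slice_props 𝔣 hNv hNt hNN z).2.2.2⟩, rfl⟩

/-- `⟪v₀ + z t₀, v₀ + z t₀⟫ = ⟪v₀,v₀⟫ + |z|² ⟪t₀,t₀⟫`. [cite: BergeronMillsonMoeglin2016Balls, Part 2 §1.3] -/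
theorem form_v₀_add_smul_t₀ (hvt : star 𝔣.v₀ ⬝ᵥ (J.map w₁.1.embedding *ᵥ 𝔣.t₀) = 0) (z : ℂ) :
    star (𝔣.v₀ + z • 𝔣.t₀) ⬝ᵥ (J.map w₁.1.embedding *ᵥ (𝔣.v₀ + z • 𝔣.t₀)) =
      star 𝔣.v₀ ⬝ᵥ (J.map w₁.1.embedding *ᵥ 𝔣.v₀) + (starRingEnd ℂ z * z) * (star 𝔣.t₀ ⬝ᵥ (J.map w₁.1.embedding *ᵥ 𝔣.t₀)) := by
  simp only [star_add, star_smul, add_dotProduct, smul_dotProduct, mulVec_add, mulVec_smul, dotProduct_add, dotProduct_smul,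
    smul_eq_mul, hvt, 𝔣.orth, mul_zero, add_zero, zero_add, Complex.star_def]
  ring

/-- **The slice disc**: with `⟪v₀,v₀⟫ = −r ⟪t₀,t₀⟫`, `s(z) v₀ = v₀ + z t₀` is NEGATIVE iff `|z|² < r`. [cite: BergeronMillsonMoeglin2016Balls, Part 2 §1.3] -/
theorem v₀_add_smul_t₀_mem_negCone_iff (hvt : star 𝔣.v₀ ⬝ᵥ (J.map w₁.1.embedding *ᵥ 𝔣.t₀) = 0) {r : ℝ}
    (hvv : star 𝔣.v₀ ⬝ᵥ (J.map w₁.1.embedding *ᵥ 𝔣.v₀) = -(r : ℂ) * (star 𝔣.t₀ ⬝ᵥ (J.map w₁.1.embedding *ᵥ 𝔣.t₀))) (z : ℂ) :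
    𝔣.v₀ + z • 𝔣.t₀ ∈ negCone (J.map w₁.1.embedding) ↔ ‖z‖ ^ 2 < r := by
  rw [mem_negCone_iff, form_v₀_add_smul_t₀ 𝔣 hvt, hvv, Complex.conj_mul' z]
  have hsum : (-(r : ℂ)) * (star 𝔣.t₀ ⬝ᵥ (J.map w₁.1.embedding *ᵥ 𝔣.t₀)) +
      ((‖z‖ : ℂ) ^ 2) * (star 𝔣.t₀ ⬝ᵥ (J.map w₁.1.embedding *ᵥ 𝔣.t₀)) =
      ((‖z‖ ^ 2 - r : ℝ) : ℂ) * (star 𝔣.t₀ ⬝ᵥ (J.map w₁.1.embedding *ᵥ 𝔣.t₀)) := by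
    push_cast
    ring
  rw [hsum, Complex.re_ofReal_mul]
  have hT := 𝔣.t₀_pos
  constructor
  · intro h
    rcases mul_neg_iff.1 h with ⟨_, h2⟩ | ⟨h1, _⟩
    · exact absurd h2 (not_lt.2 hT.le)
    · exact sub_neg.1 h1
  · intro h
    exact mul_neg_of_neg_of_pos (sub_neg.2 h) hT

end Summit.HodgeConjecture.HodgeConjecture.Cruxes.HLiu418.E2DiscSlice

end
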